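import Summits.MatrixMultiplication.OmegaCensus.STPPVosperSlackTwoCheckersC

/-!
# ω-census (abelian STPP census): `{(3,3,3),(3,3,4)} ⊄ ℤ₆₁` — slack-2 partition law, CASE C rows, part 2 (kernel computations)

HONEST FRAMING (pub-omega census; verbatim): lottery ticket; floor = certified bounds/negative ranges.
Census STRUCTURE (seat pub-omega-stpp-2 gen 27, 2026-08-28), family (b2).  Rows for the kill of the leaf `{(3,3,3),(3,3,4)} @ ℤ₆₁` by the slack-2
partition law (stpp-1 lineage: `STPPVosperSlackTwoShapes.lean`, checkers `STPPVosperSlackTwoCheckers.lean` / `…CheckersC.lean`, SPEC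
`no_isSTPP_of_slack_two_rows`): reading `(a, b, c) = (4, 3, 3)` of the block `(3,3,4)`, the other block `(a₀, b₀, c₀) = (3, 3, 3)`, `L = z = 9`.
Case C (both pairs one above Cauchy–Davenport, Hamidoune–Rødseth shapes): `caseCDeadQP' 61 3 9 9 3 3 3 Q P = true` for `Q ∈ qShapesC 3` and the
`P`-shapes `pShapesC 61 4` with indices `[10k, 10k + 10)`, `k ∈ [4, 8)` (of 24 chunks; 720 `(Q, P)` pairs in all; python mirror of the checker = stpp-1's
`slack2_pilot2.py` case C: 480 stage-3 configurations, 0 realisations).  Each theorem is ONE `decide +kernel` (≈ 15–60 s).  Assembly to the SPEC's row form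
`∀ Q ∈ qShapesC 3, ∀ P ∈ pShapesC 61 4, …` in `STPPVosperSlackTwoRows61CAsm.lean`.  Nothing here is progress on `ω`.

References: H. Cohn, R. Kleinberg, B. Szegedy, C. Umans, FOCS 2005 (arXiv:math/0511460), Def. 5.1; Y. O. Hamidoune, Ø. J. Rødseth, Acta Arith. 92 (2000).
-/

namespace Summit.MatrixMultiplication.OmegaCensus.CubeNB.S2

/-- Case C rows, `P`-shape indices `[40, 50)` (all three `Q`-shapes): the checker certifies death. [folklore] -/
theorem rowsC61_c4 : ((((pShapesC 61 4).drop 40).take 10).all fun P => (qShapesC 3).all fun Q => caseCDeadQP' 61 3 9 9 3 3 3 Q P) = true := by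
  decide +kernel

/-- Case C rows, `P`-shape indices `[50, 60)` (all three `Q`-shapes): the checker certifies death. [folklore] -/
theorem rowsC61_c5 : ((((pShapesC 61 4).drop 50).take 10).all fun P => (qShapesC 3).all fun Q => caseCDeadQP' 61 3 9 9 3 3 3 Q P) = true := by
  decide +kernel

/-- Case C rows, `P`-shape indices `[60, 70)` (all three `Q`-shapes): the checker certifies death. [folklore] -/
theorem rowsC61_c6 : ((((pShapesC 61 4).drop 60).take 10).all fun P => (qShapesC 3).all fun Q => caseCDeadQP' 61 3 9 9 3 3 3 Q P) = true := by
  decide +kernel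

/-- Case C rows, `P`-shape indices `[70, 80)` (all three `Q`-shapes): the checker certifies death. [folklore] -/
theorem rowsC61_c7 : ((((pShapesC 61 4).drop 70).take 10).all fun P => (qShapesC 3).all fun Q => caseCDeadQP' 61 3 9 9 3 3 3 Q P) = true := by
  decide +kernel

end Summit.MatrixMultiplication.OmegaCensus.CubeNB.S2
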